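import Summits.BirchSwinnertonDyer.BirchSwinnertonDyer.Theorems.TwoAdicConverseGoodOrdinaryPub
import Literature.Uncategorized.OrdPublishedInputsAtTwo
import HarnessLib

/-!
# Route `TwoAdicConverse` (rung S3), crux `GoodOrdinaryRankZeroTwoConverse`: the Eisenstein child at
# the TRIVIAL CHARACTER suffices — the converse needs `L₂ ∣ char X` only through `f_X(0) ≠ 0 ⇒ L₂(0) ≠ 0`

Cell `bsd-2adic` (run/shared/lean/pub/bsd-2adic/), seat `bsd-2adic-conv-1` (planner g12: «the shared
crux 19151 from the converse side»). THEOREMS ONLY — nothing asserted, no definition, no named fact.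
Sequel of `Theorems/TwoAdicConverseGoodOrdinaryEisensteinWeak.lean` (p418541: 19151 needed only on
the finite-`Sel` locus, up to isogeny).

The Eisenstein half `X5.O1.MainConjectureEisensteinDivisibilityAtTwo W` (child 19151) is a DIVISIBILITY
in `Λ = ℤ₂⟦T⟧`: `ι f_X = ι h · ϖ·L₂(f,α)`. The rank-`0` `2`-converse consumes only its specialisation at
the trivial character `T = 0`: «`f_X(0) ≠ 0 ⇒ L₂(f,α)(0) ≠ 0`». This file records that, kernel-checked,
with the hypothesis written INLINE in the vocabulary of the typed object (same quantifier prefix as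
`MainConjectureEisensteinDivisibilityAtTwo`, conclusion replaced by the `T = 0` implication; no new
`def`):

* `entireLFunction_one_ne_zero_of_finite_selmer_of_eisensteinAtZero` — PUBLISHED {modularity, Kato
  17.4 (1)(2) at `2` (torsion clause), Greenberg Thm. 4.1 parity-free} + the `T = 0` implication at `W`
  + `Sel_{2^∞}(W/ℚ)` finite ⟹ `L(W,1) ≠ 0`: Greenberg 4.1@2 gives `f_X(0) ≠ 0`; the hypothesis gives
  `L₂(f,α)(0) ≠ 0`; interpolation `L₂(f,α)(0) = (1 − α⁻¹)²·[0]⁺_f` (Mazur–Tate–Teitelbaum §I.14) gives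
  `[0]⁺_f ≠ 0`; `L(E,1) = [0]⁺_f·Ω⁺_f` with `Ω⁺_f > 0`.
* `goodOrdinaryRankZeroTwoConverse_of_eisensteinAtZero` — ∀-closed: PUB (item 19167's constant
  `Literature.Uncategorized.OrdConversePublishedInputsAtTwo`) + the `T = 0` implication on every non-CM
  globally minimal curve good ordinary at `2` with finite `Sel_{2^∞}` ⟹ the crux.
* `eisensteinAtZero_of_mainConjectureEisensteinDivisibilityAtTwo` — the typed Eisenstein half (19151
  at `W`) implies the `T = 0` implication at `W` (constant terms of `ι f_X = ι h · ϖ·L₂`), so this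
  bridge is WEAKER in hypothesis than the split's glue p416617.

HONEST FRAMING: on the finite-`Sel` locus the `T = 0` implication is, through Greenberg 4.1@2 and
interpolation, EQUIVALENT to the converse itself (no free lunch) — the file only pins down WHICH part
of 19151 the S3 side uses: none of the `Λ`-divisibility away from `(T)`, none of the `μ`-part. The
crux and 19151 stay open; BSD is not proved by any of this. PARTITION (D-0054): none — RANK axis (S3);
companion formula cell X5@2 good-ord (B1·O1; 611 book230 classes), object
`X5.O1.MainConjectureEisensteinDivisibilityAtTwo`, owner bsd-2adic.

References: [GreenbergLNM1716] Thm. 4.1 (p. 102), §1; [MazurTateTeitelbaum1986Invent] §I.14 (14.3);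
[Kato2004Asterisque] Thm. 17.4 (1) (p. 273); [SkinnerUrban2014] Thm. 3.6.11 (shape; p odd).
-/

set_option linter.dupNamespace false
set_option autoImplicit false

noncomputable section

open scoped Classical MatrixGroups ModularForm

open CongruenceSubgroup WeierstrassCurve Literature.NumberTheory.EllipticCurves
  Literature.NumberTheory.EllipticCurves.ModularForms
  Literature.NumberTheory.EllipticCurves.Rank1Residual
  Literature.NumberTheory.EllipticCurves.Rank1Residual.Typed
  Summit.BirchSwinnertonDyer.BirchSwinnertonDyer.Theorems.Rank1ResidualX1Defs
  Summit.BirchSwinnertonDyer.Rank1Residual.X5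
  Summit.BirchSwinnertonDyer.BirchSwinnertonDyer.Theses.TwoAdicConverse

namespace Summit.BirchSwinnertonDyer.BirchSwinnertonDyer.Theorems

/-- **`L(E,1) ≠ 0` from a finite `2^∞`-Selmer group, modulo PUBLISHED facts and the Eisenstein half AT
THE TRIVIAL CHARACTER only.** For `W` globally minimal, good ordinary at `2`: modularity (`hmod`), Kato
17.4 (1)(2)@2 (`h17`, torsion clause), Greenberg Thm. 4.1 parity-free (`hGr`), and (`hE0`) for the
cyclotomic data, the newform `f`, every dual datum `D` and generator `f_X` of `char_Λ X`:
`f_X(0) ≠ 0 ⇒ L₂(f,α)(0) ≠ 0`. If `Sel_{2^∞}(W/ℚ)` is finite then `L(W,1) ≠ 0`.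
[cite: GreenbergLNM1716, Thm. 4.1 (p. 102) and §1 (pp. 65–66)]
[cite: MazurTateTeitelbaum1986Invent, §I.14 (14.3)] [cite: Kato2004Asterisque, Thm. 17.4 (1) (p. 273)] -/
theorem entireLFunction_one_ne_zero_of_finite_selmer_of_eisensteinAtZero
    (W : WeierstrassCurve ℚ) [W.IsElliptic] [W.IsGloballyMinimal]
    (hmod : nonempty_modularParametrizationData)
    (h17 : ∀ [NeZero (W.conductorNorm ℤ)] (f : CuspForm (Gamma0 (W.conductorNorm ℤ)) 2),
      kato_divisibility_allPrimes W 2 (f := f))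
    (hGr : Greenberg1999.thm41_charValue_rankZero_anyPrime) (hgo : GoodOrd W 2)
    (hE0 : ∀ (κ : ZpExtension ℚ 2) (γ : Field.absoluteGaloisGroup ℚ),
      κ.IsCyclotomic → κ.IsTopGenerator γ → IsCyclotomicVariable 2 γ → IsOrdinaryAt W 2 →
      ∀ [NeZero (W.conductorNorm ℤ)] (f : CuspForm (Gamma0 (W.conductorNorm ℤ)) 2),
        IsNewformOf W f → ∀ (D : W.SelmerDualData κ γ) (fE : IwasawaAlgebra 2),
          D.charIdeal = Ideal.span {fE} → PowerSeries.constantCoeff fE ≠ 0 →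
            PowerSeries.constantCoeff (padicLFunction f (unitRoot W 2 : ℚ_[2])) ≠ 0)
    (hSel : Finite (W.selmerGroupPInfty 2)) : W.entireLFunction 1 ≠ 0 := by
  have hord : IsOrdinaryAt W 2 := hgo
  have hEC : O1.TwoAdicEulerCharRankZero W 0 := O1.twoAdicEulerCharRankZero_zero_of_greenberg W hGr
  haveI : NeZero (W.conductorNorm ℤ) := ⟨(W.conductorNorm_pos_holds).ne'⟩
  obtain ⟨Dm⟩ := hmod W
  have hf : IsNewformOf W Dm.f := Dm.isNewformOf
  obtain ⟨κ, hκ, γ, hγ, hγ'⟩ := exists_isCyclotomic_isTopGenerator_isCyclotomicVariable_holds 2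
  obtain ⟨D⟩ := W.nonempty_selmerDualData_holds κ γ hγ
  haveI : Module.Finite (IwasawaAlgebra 2) D.X := D.module_finite_holds hγ
  have hX : D.IsTorsion := (h17 Dm.f κ γ hκ hγ hγ' hord hf D).1
  obtain ⟨fE, hfE⟩ := (charIdeal_isPrincipal_holds 2 D.X).principal
  have hchar : D.charIdeal = Ideal.span {fE} := hfE
  haveI := hSel
  -- Greenberg Thm. 4.1 AT `2`: `f_X(0) ≠ 0`
  obtain ⟨u, hu⟩ := hEC hord κ γ hκ hγ hγ' D hX fE hchar hSel
  rw [add_zero, zpow_natCast] at hu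
  have h20 : (2 : ℚ_[2]) ≠ 0 := two_ne_zero
  have hNp0 : (Nat.card (AddCommGroup.primaryComponent
      ((integralModelInt W).map (Int.castRingHom (ZMod 2))).toAffine.Point 2) : ℚ_[2]) ≠ 0 := by
    exact_mod_cast Nat.card_pos.ne'
  have hS0 : (Nat.card (W.selmerGroupPInfty 2) : ℚ_[2]) ≠ 0 := by exact_mod_cast Nat.card_pos.ne'
  have hfE0 : ((PowerSeries.constantCoeff fE : ℤ_[2]) : ℚ_[2]) ≠ 0 := by
    intro h0
    rw [h0, zero_mul] at hu
    exact (mul_ne_zero (mul_ne_zero (mul_ne_zero (coe_units_ne_zero 2 u)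
      (pow_ne_zero _ h20)) (pow_ne_zero 2 hNp0)) hS0) hu.symm
  have hfE0' : PowerSeries.constantCoeff fE ≠ 0 := fun h0 ↦ hfE0 (by rw [h0]; simp)
  -- the Eisenstein half at the trivial character: `L₂(f,α)(0) ≠ 0`
  have hL0 : PowerSeries.constantCoeff (padicLFunction Dm.f (unitRoot W 2 : ℚ_[2])) ≠ 0 :=
    hE0 κ γ hκ hγ hγ' hord Dm.f hf D fE hchar hfE0'
  -- interpolation: `L₂(f,α)(0) = (1 - α⁻¹)² · [0]⁺_f`
  rw [constantCoeff_padicLFunction_unitRoot hord hf] at hL0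
  have hs0 : ratPlusSymbol Dm.f 0 ≠ 0 := by
    intro hs
    apply hL0
    rw [hs, Rat.cast_zero, mul_zero]
  -- `L(E,1) = [0]⁺_f · Ω⁺_f`, `Ω⁺_f > 0`
  have hper : 0 < plusPeriod Dm.f := IsNewform0.plusPeriod_pos_holds hf.1 hf.coeffField_eq_bot
  rw [hf.entireLFunction_one_eq]
  have hre : ((ratPlusSymbol Dm.f 0 : ℚ) : ℝ) * plusPeriod Dm.f ≠ 0 :=
    mul_ne_zero (by exact_mod_cast hs0) hper.ne'
  exact_mod_cast hre

/-- **The crux from PUB + the Eisenstein half at the trivial character on the finite-`Sel` locus.**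
PUBLISHED inputs (`Literature.Uncategorized.OrdConversePublishedInputsAtTwo`, item 19167) + (`hE0`):
for every non-CM globally minimal `W` good ordinary at `2` WITH `Sel_{2^∞}(W/ℚ)` FINITE, and all
cyclotomic data / newform / dual datum / generator `f_X`: `f_X(0) ≠ 0 ⇒ L₂(f,α)(0) ≠ 0`. Then
`GoodOrdinaryRankZeroTwoConverse`. [cite: GreenbergLNM1716, Thm. 4.1 (p. 102)]
[cite: MazurTateTeitelbaum1986Invent, §I.14 (14.3)] [cite: Kato2004Asterisque, Thm. 17.4 (1) (p. 273)] -/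
theorem goodOrdinaryRankZeroTwoConverse_of_eisensteinAtZero
    (hP : Literature.Uncategorized.OrdConversePublishedInputsAtTwo)
    (hE0 : ∀ (W : WeierstrassCurve ℚ) [W.IsElliptic] [W.IsGloballyMinimal], ¬ W.HasCM → GoodOrd W 2 →
      Finite (W.selmerGroupPInfty 2) →
      ∀ (κ : ZpExtension ℚ 2) (γ : Field.absoluteGaloisGroup ℚ),
        κ.IsCyclotomic → κ.IsTopGenerator γ → IsCyclotomicVariable 2 γ → IsOrdinaryAt W 2 →
        ∀ [NeZero (W.conductorNorm ℤ)] (f : CuspForm (Gamma0 (W.conductorNorm ℤ)) 2),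
          IsNewformOf W f → ∀ (D : W.SelmerDualData κ γ) (fE : IwasawaAlgebra 2),
            D.charIdeal = Ideal.span {fE} → PowerSeries.constantCoeff fE ≠ 0 →
              PowerSeries.constantCoeff (padicLFunction f (unitRoot W 2 : ℚ_[2])) ≠ 0) :
    GoodOrdinaryRankZeroTwoConverse := by
  unfold GoodOrdinaryRankZeroTwoConverse
  intro W _ _ hcm hgo hsel
  obtain ⟨hmod, h17, hGr⟩ := hP
  have hSel : Finite (W.selmerGroupPInfty 2) :=
    (finite_selmerGroupPInfty_iff_selmerCorank_eq_zero W 2).2 hsel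
  exact analyticRank_eq_zero_of_entireLFunction_one_ne_zero W
    (entireLFunction_one_ne_zero_of_finite_selmer_of_eisensteinAtZero W hmod (fun f => h17 W f) hGr
      hgo (hE0 W hcm hgo hSel) hSel)

/-- **The typed Eisenstein half implies its `T = 0` shadow** (constant terms of
`ι f_X = ι h · ϖ·L₂(f,α)`): for `W` globally minimal good ordinary at `2`, modularity and
`X5.O1.MainConjectureEisensteinDivisibilityAtTwo W` give the `T = 0` implication at `W` — so
`goodOrdinaryRankZeroTwoConverse_of_eisensteinAtZero` asks LESS than the glue of the split (p416617).
(The rational `ϖ` with `ϖ·Ω_E = Ω⁺_f` exists by modularity; it may vanish from the product only if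
`f_X(0) = 0`.) [cite: SkinnerUrban2014, Conj. 3.6.8 (p. 45) (shape; p odd)]
[cite: MazurTateTeitelbaum1986Invent, §I.14 (14.3)] -/
theorem eisensteinAtZero_of_mainConjectureEisensteinDivisibilityAtTwo
    (W : WeierstrassCurve ℚ) [W.IsElliptic] [W.IsGloballyMinimal]
    (hmod : nonempty_modularParametrizationData)
    (hE : O1.MainConjectureEisensteinDivisibilityAtTwo W) :
    ∀ (κ : ZpExtension ℚ 2) (γ : Field.absoluteGaloisGroup ℚ),
      κ.IsCyclotomic → κ.IsTopGenerator γ → IsCyclotomicVariable 2 γ → IsOrdinaryAt W 2 →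
      ∀ [NeZero (W.conductorNorm ℤ)] (f : CuspForm (Gamma0 (W.conductorNorm ℤ)) 2),
        IsNewformOf W f → ∀ (D : W.SelmerDualData κ γ) (fE : IwasawaAlgebra 2),
          D.charIdeal = Ideal.span {fE} → PowerSeries.constantCoeff fE ≠ 0 →
            PowerSeries.constantCoeff (padicLFunction f (unitRoot W 2 : ℚ_[2])) ≠ 0 := by
  intro κ γ hκ hγ hγ' hord _ f hf D fE hchar hfE0 hL0
  obtain ⟨Dm⟩ := hmod W
  obtain ⟨ϖ, -, hϖ, -⟩ := Dm.exists_rat_mul_realPeriodRat_eq_plusPeriod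
  -- transport `ϖ` to the newform `f` at hand: both are THE newform of `W`
  have hff : f = Dm.f := hf.unique Dm.isNewformOf
  subst hff
  obtain ⟨h, hh⟩ := hE κ γ hκ hγ hγ' hord Dm.f hf ϖ hϖ D fE hchar
  apply hfE0
  have hι0 : ((PowerSeries.constantCoeff fE : ℤ_[2]) : ℚ_[2]) =
      ((PowerSeries.constantCoeff h : ℤ_[2]) : ℚ_[2]) *
        ((ϖ : ℚ_[2]) * PowerSeries.constantCoeff (padicLFunction Dm.f (unitRoot W 2 : ℚ_[2]))) := by
    rw [← constantCoeff_iwasawaToPowerSeries 2 fE, hh, map_mul, map_mul,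
      constantCoeff_iwasawaToPowerSeries 2 h, PowerSeries.constantCoeff_C]
  rw [hL0, mul_zero, mul_zero] at hι0
  exact (PadicInt.coe_eq_zero).mp hι0

end Summit.BirchSwinnertonDyer.BirchSwinnertonDyer.Theorems

end
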